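import Summits.CriticalPhenomena.PercolationContinuityZ3.Theorems.FK.PressureElementaryBounds
import Literature.Probability.LatticeModels.ModifiedSimonInequality
import HarnessLib

/-!
# THE ONE-DIMENSIONAL ISING PRESSURE IN CLOSED FORM: `ψ₁(β,0) = log 2 + log cosh β`
# (the chain has no even subgraphs, so the high-temperature expansion has a single term;
# Friedli–Velenik 2017, Exercise 3.24 / §3.3; Ising 1925)

Claimed R42 (8)(c) in the cell INBOX at 2026-08-29T06:10:52Z by fkp-10a gen 358 (NEW CLAIM #6 of the gen), addressed to coordinator fk-4 gen 292 (seated 04:05Z 2026-08-29 by l.8710; R166 – R170 in force); lineage row FO-10a-g358h (self-suggested), package g358-hightemp, label OD-A.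
Helper file of the `fk-continuity` build cell (bschramm lane; `--supports stmt-CriticalPhenomena-4575`); builds on
p205010 (kernel theorem, internal audit signed; external expert review pending). No definitions, no named facts, no
sorries; standard axioms. UNCONDITIONAL (nearest-neighbour Ising chain `ℤ¹`; the tree's parametrisation
`exp(β Σ_e σ_e + βh Σ_x σ_x)`; every real `β`).

* `eq_empty_of_oddVerts_eq_empty_dim_one` — a finite edge set `F` inside a finite `Λ ⊂ ℤ¹` with no odd vertex is
  empty (the leftmost vertex touched by `F` has `F`-degree one): forests carry no nonempty even subgraph;
* `hteSum_empty_dim_one` — hence the high-temperature generating sum is `g_Λ(∅) = 1` on `ℤ¹`, for every `t`;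
* **`isingPartitionFunction_free_dim_one`** — `Z^∅_{Λ;β,0} = 2^{|Λ|} (cosh β)^{|E_Λ|}` for EVERY finite `Λ ⊂ ℤ¹` and
  every real `β` (tree HTE `isingPartitionFunction_free_eq_hteSum`); for the chain `Λ_N` this is the textbook
  `Z_N = 2 (2 cosh β)^{N−1}`… in the normalisation `2^N cosh^{N−1} β`;
* **`pressure_dim_one_zero_field`** — `ψ₁(β,0) = pressure 1 β 0 = log 2 + log cosh β` for every real `β` (box limit,
  `|E_{Λ_N}|/|Λ_N| → 1`); consequences: `hasDerivAt_pressure_dim_one_zero_field` (the energy density per site is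
  `u₁(β) = tanh β`), `contDiff_pressure_dim_one_zero_field` (`ψ₁(·,0)` is `C^n` for every `n`: no phase transition in
  the temperature variable at `h = 0` in one dimension), `pressure_dim_one_zero_field_lt` (`ψ₁(β,0) < log 2 + |β|`,
  the elementary upper bound `βd + log 2` is never attained for `β ≠ 0`).

## References

* S. Friedli, Y. Velenik, *Statistical Mechanics of Lattice Systems*, CUP (2017), §3.3 (one-dimensional model),
  Exercise 3.24, §3.7.3 (high-temperature expansion). [FriedliVelenik2017]
* E. Ising, *Beitrag zur Theorie des Ferromagnetismus*, Z. Phys. 31 (1925) 253–258 (the original computation).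
* H. Duminil-Copin, *Lectures on the Ising and Potts models on the hypercubic lattice*, §2.2.1. [DuminilCopinECM2018]
-/

noncomputable section

namespace Summit.CriticalPhenomena.PercolationContinuityZ3.Theorems.FK

namespace IsingPressure

open MeasureTheory Filter Topology Finset Set
open Literature.Probability.LatticeModels

/-! ### The chain has no nonempty even subgraphs -/

/-- **No even subgraphs on the line**: if `F ⊆ E_Λ` is a finite set of nearest-neighbour edges of `ℤ¹` inside `Λ` and
every vertex of `Λ` has even `F`-degree, then `F = ∅` — the vertex of smallest coordinate touched by `F` has
`F`-degree exactly one. [folklore] [cite: FriedliVelenik2017, §3.7.3] -/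
theorem eq_empty_of_oddVerts_eq_empty_dim_one {Λ : Finset (Site 1)} {F : Finset (Sym2 (Site 1))}
    (hF : F ⊆ edgesIn (zdGraph 1) Λ) (hodd : oddVerts Λ F = ∅) : F = ∅ := by
  classical
  by_contra hne
  obtain ⟨e₀, he₀⟩ := nonempty_iff_ne_empty.2 hne
  -- the set of vertices touched by `F`
  set S : Finset (Site 1) := Λ.filter (fun x => ∃ e ∈ F, x ∈ e) with hS
  have hSmem : ∀ {x : Site 1} {e : Sym2 (Site 1)}, e ∈ F → x ∈ e → x ∈ S := fun {x e} he hx =>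
    mem_filter.2 ⟨(mem_edgesIn_iff.1 (hF he)).2 x hx, e, he, hx⟩
  have hSne : S.Nonempty := by
    induction e₀ using Sym2.ind with
    | _ a b => exact ⟨a, hSmem he₀ (Sym2.mem_mk_left a b)⟩
  -- the leftmost touched vertex
  obtain ⟨x, hxS, hxmin⟩ := S.exists_min_image (fun z : Site 1 => z 0) hSne
  obtain ⟨hxΛ, e₁, he₁F, hxe₁⟩ := mem_filter.1 hxS
  -- every edge of `F` at `x` is the edge to the right neighbour `x + 𝟙`
  set r : Site 1 := x + Pi.single (0 : Fin 1) 1 with hr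
  have hedge : ∀ e ∈ F, x ∈ e → e = s(x, r) := by
    intro e he hxe
    obtain ⟨z, rfl⟩ := Sym2.mem_iff_exists.1 hxe
    have hadj : (zdGraph 1).Adj x z := by
      have := (mem_edgesIn_iff.1 (hF he)).1
      rwa [SimpleGraph.mem_edgeSet] at this
    obtain ⟨i, hz | hx⟩ := (zdGraph_adj_iff x z).1 hadj
    · obtain rfl : i = 0 := Subsingleton.elim _ _
      rw [hz]
    · -- `z = x − 𝟙` lies to the left of `x` and is touched by `F`: impossible
      exfalso
      obtain rfl : i = 0 := Subsingleton.elim _ _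
      have hzS : z ∈ S := hSmem he (Sym2.mem_mk_right x z)
      have h1 := hxmin z hzS
      have h2 : x 0 = z 0 + 1 := by
        have := congrArg (fun f : Site 1 => f 0) hx
        simpa using this
      linarith
  -- so `F`-degree of `x` is one: `x` is an odd vertex
  have hfilter : F.filter (fun e => x ∈ e) = {s(x, r)} := by
    refine eq_singleton_iff_unique_mem.2 ⟨?_, fun e he => ?_⟩
    · have := hedge e₁ he₁F hxe₁
      subst this
      exact mem_filter.2 ⟨he₁F, hxe₁⟩
    · exact hedge e (mem_filter.1 he).1 (mem_filter.1 he).2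
  have hxodd : x ∈ oddVerts Λ F := by
    rw [oddVerts, mem_filter, hfilter, Finset.card_singleton]
    exact ⟨hxΛ, odd_one⟩
  rw [hodd] at hxodd
  exact notMem_empty x hxodd

/-- **`g_Λ(∅) = 1` on `ℤ¹`**: the only even subgraph of a finite piece of the chain is the empty one, for every `t`.
[cite: FriedliVelenik2017, §3.7.3] [cite: DuminilCopinECM2018, §2.2.1 (high-temperature expansion)] -/
theorem hteSum_empty_dim_one (Λ : Finset (Site 1)) (t : ℝ) : hteSum (zdGraph 1) Λ t ∅ = 1 := by
  rw [hteSum]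
  have hset : (edgesIn (zdGraph 1) Λ).powerset.filter (fun F => oddVerts Λ F = ∅) = {∅} := by
    ext F
    simp only [mem_filter, Finset.mem_powerset, Finset.mem_singleton]
    constructor
    · rintro ⟨hF, hoddF⟩
      exact eq_empty_of_oddVerts_eq_empty_dim_one hF hoddF
    · rintro rfl
      exact ⟨empty_subset _, oddVerts_empty Λ⟩
  rw [hset, sum_singleton, Finset.card_empty, pow_zero]

/-- **`Z^∅_{Λ;β,0} = 2^{|Λ|} (cosh β)^{|E_Λ|}` on `ℤ¹`** for every finite `Λ` and every real `β`: the high-temperature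
expansion `Z = 2^{|Λ|} cosh(β)^{|E_Λ|} g_Λ(∅)` with `g_Λ(∅) = 1`. For the chain `{1,…,N}` (`N − 1` edges) this is Ising's
`Z_N = 2^N cosh^{N−1} β`. [cite: FriedliVelenik2017, §3.3 and Exercise 3.24] -/
theorem isingPartitionFunction_free_dim_one (Λ : Finset (Site 1)) (β : ℝ) :
    isingPartitionFunction (zdGraph 1) Λ β 0 .free = (2 : ℝ) ^ #Λ * Real.cosh β ^ #(edgesIn (zdGraph 1) Λ) := by
  rw [isingPartitionFunction_free_eq_hteSum, hteSum_empty_dim_one, mul_one, card_spinConfig_coe]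
  push_cast
  ring

/-- Finite-volume pressure of the chain: `ψ^∅_Λ(β,0) = log 2 + (|E_Λ|/|Λ|) log cosh β` (`Λ ≠ ∅`).
[cite: FriedliVelenik2017, §3.3 and Exercise 3.24] -/
theorem pressureIn_free_dim_one {Λ : Finset (Site 1)} (hΛ : Λ.Nonempty) (β : ℝ) :
    pressureIn (zdGraph 1) Λ β 0 .free =
      Real.log 2 + (#(edgesIn (zdGraph 1) Λ) : ℝ) / #Λ * Real.log (Real.cosh β) := by
  have hpos : (0 : ℝ) < #Λ := by exact_mod_cast hΛ.card_pos
  rw [pressureIn, isingPartitionFunction_free_dim_one, Real.log_mul (by positivity) (by positivity), Real.log_pow,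
    Real.log_pow]
  field_simp

/-! ### The thermodynamic limit in closed form -/

/-- **ISING 1925: `ψ₁(β,0) = log 2 + log cosh β`** for every real `β` — the pressure of the nearest-neighbour Ising chain
in zero field (`pressure 1 β 0`, the tree's box limit), from `ψ^∅_{Λ_N}(β,0) = log 2 + (|E_{Λ_N}|/|Λ_N|) log cosh β` and
`|E_{Λ_N}|/|Λ_N| → 1`. Equivalently `f₁(β,0) = −β⁻¹(log 2 + log cosh β)`; the transfer-matrix eigenvalue is
`λ₊ = e^β + e^{−β} = 2 cosh β`. [cite: FriedliVelenik2017, §3.3 and Exercise 3.24] -/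
theorem pressure_dim_one_zero_field (β : ℝ) : pressure 1 β 0 = Real.log 2 + Real.log (Real.cosh β) := by
  have hlim : Tendsto (fun L : ℕ => pressureIn (zdGraph 1) (box 1 L) β 0 .free) atTop (𝓝 (pressure 1 β 0)) :=
    hasBoxLimit_pressureIn_holds (d := 1) β 0 .free
  have h : Tendsto (fun L : ℕ => Real.log 2 +
      (((edgesIn (zdGraph 1) (box 1 L)).card : ℝ) / (box 1 L).card) * Real.log (Real.cosh β)) atTop
      (𝓝 (Real.log 2 + ((1 : ℕ) : ℝ) * Real.log (Real.cosh β))) :=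
    tendsto_const_nhds.add ((tendsto_card_edgesIn_box_div_card_box (d := 1)).mul_const _)
  rw [Nat.cast_one, one_mul] at h
  have hexact : Tendsto (fun L : ℕ => pressureIn (zdGraph 1) (box 1 L) β 0 .free) atTop
      (𝓝 (Real.log 2 + Real.log (Real.cosh β))) :=
    Tendsto.congr (fun L => (pressureIn_free_dim_one (box_nonempty 1 L) β).symm) h
  exact tendsto_nhds_unique hlim hexact

/-- **The energy density of the chain is `u₁(β) = tanh β`**: `d/dβ ψ₁(β,0) = tanh β` (every real `β`).
[cite: FriedliVelenik2017, §3.3 and Exercise 3.24] -/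
theorem hasDerivAt_pressure_dim_one_zero_field (β : ℝ) :
    HasDerivAt (fun b => pressure 1 b 0) (Real.tanh β) β := by
  have hfun : (fun b => pressure 1 b 0) = fun b => Real.log 2 + Real.log (Real.cosh b) :=
    funext pressure_dim_one_zero_field
  rw [hfun, Real.tanh_eq_sinh_div_cosh]
  exact ((Real.hasDerivAt_cosh β).log (Real.cosh_pos β).ne').const_add _

/-- **No phase transition in one dimension (temperature variable, zero field)**: `β ↦ ψ₁(β,0)` is `C^n` on all of `ℝ`
for every `n`. [cite: FriedliVelenik2017, §3.3] -/
theorem contDiff_pressure_dim_one_zero_field (n : ℕ) : ContDiff ℝ n (fun b => pressure 1 b 0) := by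
  have hfun : (fun b => pressure 1 b 0) = fun b => Real.log 2 + Real.log (Real.cosh b) :=
    funext pressure_dim_one_zero_field
  rw [hfun]
  exact contDiff_const.add (Real.contDiff_cosh.log fun x => (Real.cosh_pos x).ne')

/-- **`ψ₁(β,0) < log 2 + |β|` for `β ≠ 0`**: in one dimension the elementary upper bound `ψ(β,0) ≤ |β|d + log 2`
(`pressure_le_abs_mul_add_log_two`) is strict — `cosh β < e^{|β|}`. [cite: FriedliVelenik2017, §3.3, Thm. 3.6 (proof)] -/
theorem pressure_dim_one_zero_field_lt {β : ℝ} (hβ : β ≠ 0) : pressure 1 β 0 < Real.log 2 + |β| := by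
  rw [pressure_dim_one_zero_field, add_lt_add_iff_left]
  have hlt : Real.cosh β < Real.exp |β| := by
    rw [Real.cosh_eq]
    rcases lt_or_gt_of_ne hβ with h | h
    · rw [abs_of_neg h]
      have : Real.exp β < Real.exp (-β) := Real.exp_lt_exp.2 (by linarith)
      linarith
    · rw [abs_of_pos h]
      have : Real.exp (-β) < Real.exp β := Real.exp_lt_exp.2 (by linarith)
      linarith
  calc Real.log (Real.cosh β) < Real.log (Real.exp |β|) := Real.log_lt_log (Real.cosh_pos β) hlt
    _ = |β| := Real.log_exp _

end IsingPressure

end Summit.CriticalPhenomena.PercolationContinuityZ3.Theorems.FK
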